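import Summits.QuantumFields.YangMills.Theorems.BalabanUVNodesK2AtRecord13CoreTopRuns

/-!
# DAG node N26 ∕ crux K2 — THE K2-LANE FACES OF THIS LINEAGE IN TOWER-GENERIC ∕ DATUM-GENERIC FORM, immune to NODE 00's background re-base (director-ym №152 RULING (β): the record's
# background moves to print's Co-class minimiser `UbgMSCoOfRecord`; def-T KEY-RULE-21: `coreOfRecord₁₃ ↦ coreOfRecord₁₃Co`, `towerOfRecord₁₃Core ↦ towerOfRecord₁₃Co`, `datumOfRecord₁₃Core ↦
# datumOfRecord₁₃Co`, editions `…SepCo`; the β of record `betaOfRecord₁₃ θ` is background-FREE and UNCHANGED)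

Cell `pub-ymgap`, YM-PLAN Track A (HUMAN RULING D-0062), seat `pub-ymgap-dag-n26-c` gen 9 (R134 acceleration seat, s2); helper for crux K2⁗ `EndpointGivenBR13Sep` (stmt-QuantumFields-20291;
rev-20 successor K2⁵ on the `SepCo` edition).  WHY: this lineage's Core-keyed faces (p510090 `…N26AtRecord13Core`, p512371 `…K2AtRecord13CoreTopRuns` §0–§1, p510830 ∕ p514822's Core-datum
faces) are keyed at v1.2's `datumOfRecord₁₃Core` = `datumOfTower F N (coreOfRecord₁₃ θ) (towerOfRecord₁₃Core θ hc)`, whose CORE reads the OLD background; after №152 the items' data are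
`datumOfTower F N (coreOfRecord₁₃Co θ) (towerOfRecord₁₃Co θ hc)` (def-T FILE 21 `Node00/Record13Co.lean`, pending).  Every N26 ∕ K2 face of this lineage reads the datum ONLY through
`D.βfun` (= `betaOfRecord₁₃ θ` for every core of record, `rfl`), `D.fwd` and — for the top-run criterion — the modelling clause `HaltsOutside`, which holds for EVERY
`T4DatumAssembly.RGMachineCore` tower datum (`RGMachineCore.haltsOutside`).  So the faces are stated here ONCE for (a) ANY finite-ε datum `D` with `hD : D.βfun = betaOfRecord₁₃ F N θ`
(p509259's shape) and (b) ANY tower datum `datumOfTower F N M τ` with `hM : M.βfun = betaOfRecord₁₃ F N θ`; the Co data (and any later core) are instances by `rfl`.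

WHAT IS HERE (0 `def`, 0 `sorry`; one application of a landed theorem each):
* §0 ANY tower datum (any core `M`, any tower `τ` over the averaging of record): `haltsOutside_datumOfTower`, ★ `endpointExistence_datumOfTower_iff_topRuns` (the gaps cell's two-way
  top-run criterion with `HaltsOutside` DISCHARGED — B4 + (U) + non-crossing on `M.βfun` displayed).
* §1 ANY datum `D` with `hD : D.βfun = betaOfRecord₁₃ F N θ` (the faces p509259 §1 does not already carry): `n26_of_βfun_eq_of_betaContH` (the universal adapter),
  `endpoint_and_n26_of_βfun_eq_of_residue_atSlopeCont` (the REGISTERED currency: (D1) residue pinned on a split of `betaOfRecord₁₃ θ` + `AtSlopeCont` at its slope).  (The jets-free drift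
  road, the chain-free roads and the merged forms in this shape ARE p509259 `endpoint_and_n26_of_drift_atSlopeCont₁₃'` ∕ `…_of_monotoneSign₁₃` ∕ `…_of_merged_cont_upper_sign₁₃` etc.)
* §2 ANY tower datum whose core carries the β of record (`hM`): `endpointExistence_datumOfTower_iff_topRuns_merged₁₃` (B4 ∕ (U) read on the merged β `β_m`, `γ₀ ≤ θ.γ`) and ★
  `endpointExistence_datumOfTower_iff_topRuns_allMerged₁₃` (non-crossing too, from cooperativity + last-coupling Lipschitz on `β_m`: p512371 `hord_betaOfRecord₁₃_of_cooperative_lastLipschitz_merged`).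
USE: at def-T's Co data take `M := coreOfRecord₁₃Co F N θ`, `τ := towerOfRecord₁₃Co F N θ hc`, `hM := rfl` (resp. `D := datumOfRecord₁₃Co F N θ hc`, `hD := rfl`); at an item edition
`…SepCo` the datum IS the Co datum at `h.toCore` (`datumOfRecord₁₃SepCo_eq_co`, `rfl`).

HONEST FRAMING.  Reductions ∕ equivalences between displayed predicates; every antecedent (B4, (U), non-crossing ∕ cooperativity ∕ Lipschitz, the residue, `AtSlopeCont`) is a HYPOTHESIS
proved nowhere for Bałaban's objects (instance 0∕1); nothing of Bałaban's analysis asserted; K2 ∕ `stub_d1Residue13` ∕ `stub_d4AtSlopeCont13` NOT proved; N25 ∕ N26 NOT discharged (N26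
VACATED ∕ (D4)-dependent; counts unmoved 5∕27 · A 5∕28); general `N`; one finite four-torus programme at fixed ε per run — NOT the continuum limit, NOT ℝ⁴, NOT OS, NOT a mass gap, NOT
Clay.  No `instance`, no `notation`, no `axiom`.
Sources (context): [I] = [Balaban1987RG1] CMP **109** (1987): Thm 2 p. 259 (first sentence), (0.18)–(0.20) pp. 255–256, (0.31) p. 259, (1.20)–(1.22) p. 264, (2.12)–(2.14) p. 268, §5
p. 298; [II] = [Balaban1988RG2Cluster] CMP **116** (1988): Lemma 3 (2.38) p. 20; [6] = [Balaban1989LargeFieldII] CMP **122** (1989): Thm 1 + (0.1) pp. 355–356, (1.7)∕(1.9) p. 77 (the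
Co class, director-ym №152).
-/

noncomputable section

open scoped Matrix.Norms.L2Operator

namespace Summit.QuantumFields.YangMills.Theorems.BalabanUVNodesK2AtBetaOfRecord13TowerGeneric

open Literature.MathematicalPhysics.QuantumFieldTheory.Balaban1983to89
open Literature.MathematicalPhysics.QuantumFieldTheory.Balaban1983to89.FlowStep
open Literature.MathematicalPhysics.QuantumFieldTheory.Balaban1983to89.FlowStepRuns (HaltsOutside)
open Literature.MathematicalPhysics.QuantumFieldTheory.Balaban1983to89.DagBinding (EndpointExistence)
open Literature.MathematicalPhysics.QuantumFieldTheory.Balaban1983to89.T4Continuum (T4Family FiniteEpsData)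
open Literature.MathematicalPhysics.QuantumFieldTheory.Balaban1983to89.T4DatumAssembly
open Literature.MathematicalPhysics.QuantumFieldTheory.Balaban1983to89.Node00
open Literature.MathematicalPhysics.QuantumFieldTheory.Balaban1983to89.Beta.OneStepKernelFamily (TbalOf)
open Literature.MathematicalPhysics.QuantumFieldTheory.Balaban1983to89.Beta.OneStepResolventKernel (JetData)
open Summit.QuantumFields.BalabanUV.Gaps
open Summit.QuantumFields.BalabanUV.Gaps.BetaContFromD4Chain
open Summit.QuantumFields.BalabanUV.Gaps.EndRunwiseHeadline (endpointExistence_datum_iff_topRuns)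
open Summit.QuantumFields.YangMills.Theorems.BalabanUVNodesN26AtRecord13 (betaContH_betaOfRecord₁₃_iff)
open Summit.QuantumFields.YangMills.Theorems.BalabanUVNodesK2AtBetaOfRecord13ChainFree (betaUpperH_betaOfRecord₁₃_iff)
open Summit.QuantumFields.YangMills.Theorems.BalabanUVNodesK2AtRecord13CoreTopRuns (hord_betaOfRecord₁₃_of_cooperative_lastLipschitz_merged)
open Filter Topology

variable (F : T4Family) (N : ℕ) [NeZero N]

/-! ## §0 Any tower datum: `HaltsOutside` is a theorem; the two-way top-run criterion -/

section Tower

variable (M : RGMachineCore F (Matrix.specialUnitaryGroup (Fin N) ℂ)) (τ : M.Tower (avOfRecord F N))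

/-- **`HaltsOutside` FOR EVERY TOWER DATUM OF RECORD** (any core `M`, any tower `τ` over the averaging of record): the construction is `M.construction τ.ρ` and the β is `M.βfun`
(`datumOfTower_C` ∕ `datumOfTower_βfun`, `rfl`), so the third modelling clause is `RGMachineCore.haltsOutside`.  Covers v1.2's `datumOfRecord₁₃Core ∕ …Sep`, v1.3's `…SepMixed`,
def-T's Co data `datumOfRecord₁₃Co ∕ …SepCo` and any later core. [cite: Balaban1987RG1, (0.18)–(0.20) pp.255–256 (bookkeeping: the coupling recursion of record)] -/
theorem haltsOutside_datumOfTower : HaltsOutside (datumOfTower F N M τ).C.toB12 (datumOfTower F N M τ).βfun :=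
  M.haltsOutside τ.ρ

/-- **★ `EndpointExistence` ⟺ THE TOP-RUN CONDITION FOR EVERY TOWER DATUM OF RECORD** (`Gaps.EndRunwiseHeadline.endpointExistence_datum_iff_topRuns` with `HaltsOutside` DISCHARGED by
`haltsOutside_datumOfTower`): given B4 on `]0,γ₀]` and the printed upper bound (U) for `M.βfun`, and non-crossing of the in-interval runs at every level `γ ≤ γ₀`,
`EndpointExistence (datumOfTower F N M τ).C.toB12 ↔ «no backsliding from the top»`.  Neither side proved; the three hypotheses are displayed (instance 0∕1). [cite: Balaban1987RG1, Thm 2 p.259 (first sentence) and (0.20) p.256] -/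
theorem endpointExistence_datumOfTower_iff_topRuns {γ₀ β' : ℝ} (hγ₀ : 0 < γ₀) (hβ' : 0 ≤ β')
    (hcont : BetaContH γ₀ M.βfun) (hhi : BetaUpperH β' γ₀ M.βfun)
    (hord : ∀ γ : ℝ, 0 < γ → γ ≤ γ₀ → ∀ (n : ℕ) (gs gs' : ℕ → ℝ), RGEqH n M.βfun gs → RGEqH n M.βfun gs' →
      Step.InInterval γ n gs → Step.InInterval γ n gs' → gs 0 < gs' 0 → ∀ k, k ≤ n → gs k < gs' k) :
    EndpointExistence (datumOfTower F N M τ).C.toB12 ↔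
      ∃ γ₂ : ℝ, 0 < γ₂ ∧ ∀ γ : ℝ, 0 < γ → γ ≤ γ₂ → ∃ gstar : ℝ, 0 < gstar ∧
        ∀ (n : ℕ) (gs : ℕ → ℝ), RGEqH n M.βfun gs → Step.InInterval γ n gs → ∀ k, k ≤ n → gs k = γ → gstar ≤ gs n :=
  endpointExistence_datum_iff_topRuns (datumOfTower F N M τ) (haltsOutside_datumOfTower F N M τ) hγ₀ hβ' hcont hhi hord

end Tower

/-! ## §1 Any datum carrying the β of record: the adapter and the registered currency -/

section Datum

variable (θ : Stage13Params F N) (D : FiniteEpsData F (Matrix.specialUnitaryGroup (Fin N) ℂ)) (hD : D.βfun = betaOfRecord₁₃ F N θ)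
include hD

/-- **THE UNIVERSAL ADAPTER, DATUM-GENERIC**: any `BetaContH γ₀ (betaOfRecord₁₃ F N θ)` face with `0 < γ₀` ⟹ N26's literal at EVERY datum `D` whose β IS the β of record (`hD`).
Instance 0∕1; N26 NOT discharged. [cite: Balaban1987RG1, (1.20)–(1.22) p.264; Balaban1989LargeFieldII, Thm 1 + (0.1) pp.355–356 (the record)] -/
theorem n26_of_βfun_eq_of_betaContH {γ₀ : ℝ} (hγ₀ : 0 < γ₀) (h : BetaContH γ₀ (betaOfRecord₁₃ F N θ)) :
    ∃ γc : ℝ, 0 < γc ∧ BetaContH γc D.βfun :=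
  ⟨γ₀, hγ₀, hD ▸ h⟩

/-- **N25's END ∧ N26 AT EVERY DATUM CARRYING THE β OF RECORD, REGISTERED (residue) CURRENCY**: row (D1)'s residue `Gaps.D1Residue.Residue Lc Js Nc μ ν` pinned on the one-loop field of a
split `Sβ` of `betaOfRecord₁₃ F N θ` + the rows-(D4) ∧ B4 residue `AtSlopeCont Sβ γ₀ (stepBal Nc Lc)` on a box `0 < γ₀` ⟹ `EndpointExistence D.C.toB12 ∧ ∃ γc > 0, BetaContH γc D.βfun`
(`Gaps.BetaContFromD4Chain.endpointExistence_of_residue_atSlopeCont` at the datum's own `fwd`, transported along `hD`).  Instance 0∕1 on both predicates.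
[cite: Balaban1987RG1, Thm 2 p.259 (first sentence), (1.20)–(1.22) p.264 and (2.12)–(2.14) p.268; Balaban1988RG2Cluster, Lemma 3 (2.38) p.20] -/
theorem endpoint_and_n26_of_βfun_eq_of_residue_atSlopeCont (Sβ : B12Beta.OneLoopSplit (betaOfRecord₁₃ F N θ)) {Lc : ℕ} [NeZero Lc] (Js : ℕ → JetData 3 Lc)
    {Nc : ℝ} {μ ν : Fin 4} (hβ : ∀ j, Sβ.β0 j = B12Beta.secondMoment (TbalOf Lc Js j) μ ν) (h1 : D1Residue.Residue Lc Js Nc μ ν) {γ₀ : ℝ} (hγ₀ : 0 < γ₀)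
    (hres : AtSlopeCont Sβ γ₀ (B12Normalization.stepBal Nc Lc)) :
    EndpointExistence D.C.toB12 ∧ ∃ γc : ℝ, 0 < γc ∧ BetaContH γc D.βfun :=
  ⟨endpointExistence_of_residue_atSlopeCont (β := betaOfRecord₁₃ F N θ) (hD ▸ D.fwd) Sβ Js hβ h1 hγ₀ hres, γ₀, hγ₀, hD ▸ betaContH_of_atSlopeCont hres⟩

end Datum

/-! ## §2 Any tower datum whose core carries the β of record: the top-run equivalence read on the merged β -/

section TowerAtRecord

variable (θ : Stage13Params F N) (M : RGMachineCore F (Matrix.specialUnitaryGroup (Fin N) ℂ)) (τ : M.Tower (avOfRecord F N)) (hM : M.βfun = betaOfRecord₁₃ F N θ)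
include hM

/-- **END ⟺ TOP RUNS for every tower datum whose core carries the β of record, with B4 and (U) READ ON THE MERGED β** `β_m` on `]0,γ₀]^{k+1}` (`0 < γ₀ ≤ θ.γ`; p491248
`betaContH_betaOfRecord₁₃_iff`, p509259 `betaUpperH_betaOfRecord₁₃_iff`); non-crossing of the runs of the β of record displayed.  Instance 0∕1. [cite: Balaban1987RG1, Thm 2 p.259 (first sentence), (0.31) p.259 and (1.20)–(1.22) p.264] -/
theorem endpointExistence_datumOfTower_iff_topRuns_merged₁₃ {γ₀ β' : ℝ} (hγ₀ : 0 < γ₀) (hle : γ₀ ≤ θ.γ) (hβ' : 0 ≤ β')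
    (hcont : letI := θ.instVβ₁; letI := θ.instVβ₂; letI := θ.instιβ
      ∀ k, ContinuousOn (betaMerged F (mergedTermFamilyMatT F N (TcanOfRecord F N) (chiFixed29 F N θ.ν θ.ε₂₉) θ.εbg) θ.ρ8 θ.bV k) (Box γ₀ k))
    (hhi : letI := θ.instVβ₁; letI := θ.instVβ₂; letI := θ.instιβ
      ∀ k (v : Fin (k + 1) → ℝ), v ∈ Box γ₀ k →
        betaMerged F (mergedTermFamilyMatT F N (TcanOfRecord F N) (chiFixed29 F N θ.ν θ.ε₂₉) θ.εbg) θ.ρ8 θ.bV k v ≤ β')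
    (hord : ∀ γ : ℝ, 0 < γ → γ ≤ γ₀ → ∀ (n : ℕ) (gs gs' : ℕ → ℝ), RGEqH n (betaOfRecord₁₃ F N θ) gs → RGEqH n (betaOfRecord₁₃ F N θ) gs' →
      Step.InInterval γ n gs → Step.InInterval γ n gs' → gs 0 < gs' 0 → ∀ k, k ≤ n → gs k < gs' k) :
    EndpointExistence (datumOfTower F N M τ).C.toB12 ↔
      ∃ γ₂ : ℝ, 0 < γ₂ ∧ ∀ γ : ℝ, 0 < γ → γ ≤ γ₂ → ∃ gstar : ℝ, 0 < gstar ∧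
        ∀ (n : ℕ) (gs : ℕ → ℝ), RGEqH n (betaOfRecord₁₃ F N θ) gs → Step.InInterval γ n gs → ∀ k, k ≤ n → gs k = γ → gstar ≤ gs n := by
  have h := endpointExistence_datumOfTower_iff_topRuns F N M τ (γ₀ := γ₀) (β' := β') hγ₀ hβ'
  rw [hM] at h
  exact h ((betaContH_betaOfRecord₁₃_iff F N θ hle).2 hcont) ((betaUpperH_betaOfRecord₁₃_iff F N θ hle β').2 hhi) hord

/-- **★ END ⟺ TOP RUNS for every tower datum whose core carries the β of record, with EVERY hypothesis a sentence about the merged β on `]0,γ₀]^{k+1}`** (`0 < γ₀ ≤ θ.γ`): per-`k`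
continuity, `β_m ≤ β'`, cooperativity in the past couplings, last-coupling Lipschitz `M₀` with `M₀·γ₀³ < 2` (p512371 `hord_betaOfRecord₁₃_of_cooperative_lastLipschitz_merged`).  Neither
side proved; instance 0∕1. [cite: Balaban1987RG1, Thm 2 p.259 (first sentence), (0.20) p.256, (0.31) p.259, (1.20)–(1.22) p.264 and §5 p.298] -/
theorem endpointExistence_datumOfTower_iff_topRuns_allMerged₁₃ {γ₀ β' M₀ : ℝ} (hγ₀ : 0 < γ₀) (hle : γ₀ ≤ θ.γ) (hβ' : 0 ≤ β')
    (hcont : letI := θ.instVβ₁; letI := θ.instVβ₂; letI := θ.instιβ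
      ∀ k, ContinuousOn (betaMerged F (mergedTermFamilyMatT F N (TcanOfRecord F N) (chiFixed29 F N θ.ν θ.ε₂₉) θ.εbg) θ.ρ8 θ.bV k) (Box γ₀ k))
    (hhi : letI := θ.instVβ₁; letI := θ.instVβ₂; letI := θ.instιβ
      ∀ k (v : Fin (k + 1) → ℝ), v ∈ Box γ₀ k →
        betaMerged F (mergedTermFamilyMatT F N (TcanOfRecord F N) (chiFixed29 F N θ.ν θ.ε₂₉) θ.εbg) θ.ρ8 θ.bV k v ≤ β')
    (hcoop : letI := θ.instVβ₁; letI := θ.instVβ₂; letI := θ.instιβ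
      ∀ (k : ℕ) (v v' : Fin (k + 1) → ℝ), v ∈ Box γ₀ k → v' ∈ Box γ₀ k → (∀ i, v i ≤ v' i) → v (Fin.last k) = v' (Fin.last k) →
        betaMerged F (mergedTermFamilyMatT F N (TcanOfRecord F N) (chiFixed29 F N θ.ν θ.ε₂₉) θ.εbg) θ.ρ8 θ.bV k v ≤
          betaMerged F (mergedTermFamilyMatT F N (TcanOfRecord F N) (chiFixed29 F N θ.ν θ.ε₂₉) θ.εbg) θ.ρ8 θ.bV k v')
    (hlast : letI := θ.instVβ₁; letI := θ.instVβ₂; letI := θ.instιβ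
      ∀ (k : ℕ) (v : Fin (k + 1) → ℝ), v ∈ Box γ₀ k → ∀ x y : ℝ, 0 < x → x ≤ γ₀ → 0 < y → y ≤ γ₀ →
        |betaMerged F (mergedTermFamilyMatT F N (TcanOfRecord F N) (chiFixed29 F N θ.ν θ.ε₂₉) θ.εbg) θ.ρ8 θ.bV k (Function.update v (Fin.last k) x) -
            betaMerged F (mergedTermFamilyMatT F N (TcanOfRecord F N) (chiFixed29 F N θ.ν θ.ε₂₉) θ.εbg) θ.ρ8 θ.bV k (Function.update v (Fin.last k) y)| ≤ M₀ * |x - y|)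
    (hM₀ : 0 ≤ M₀) (hsmall : M₀ * γ₀ ^ 3 < 2) :
    EndpointExistence (datumOfTower F N M τ).C.toB12 ↔
      ∃ γ₂ : ℝ, 0 < γ₂ ∧ ∀ γ : ℝ, 0 < γ → γ ≤ γ₂ → ∃ gstar : ℝ, 0 < gstar ∧
        ∀ (n : ℕ) (gs : ℕ → ℝ), RGEqH n (betaOfRecord₁₃ F N θ) gs → Step.InInterval γ n gs → ∀ k, k ≤ n → gs k = γ → gstar ≤ gs n :=
  endpointExistence_datumOfTower_iff_topRuns_merged₁₃ F N θ M τ hM hγ₀ hle hβ' hcont hhi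
    (hord_betaOfRecord₁₃_of_cooperative_lastLipschitz_merged F N θ hγ₀ hle hcoop hlast hM₀ hsmall)

end TowerAtRecord

end Summit.QuantumFields.YangMills.Theorems.BalabanUVNodesK2AtBetaOfRecord13TowerGeneric

end
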